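import Mathlib
import HarnessLib
import Summits.ValiantsHypothesis.ValiantsHypothesis.Theorems.LacunarySymmetroidMatrixDescartesOsculationLawRankOneCurve
import Summits.ValiantsHypothesis.ValiantsHypothesis.Theorems.LacunarySymmetroidMatrixDescartesOsculationLawUniformSubresultantSupport

/-!
# ValiantsHypothesis / LacunarySymmetroid — crux `MatrixDescartes` (stmt-ValiantsHypothesis-18050, V1),
# line «osculation-law»: UNIFORM columns, part 5 — a letter of ANY rank and its bordered log-Hessian as
# bivariate polynomials `P, H ∈ ℝ[t][b]`

θ-calculus for `Φ = Σ_{k ≤ n} X₁^k · ι(c_k)` (`ι : ℝ[X] → ℝ[X₀,X₁]`, `X ↦ X₀`; every rank-`r` letter has this form by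
`OsculationLetter.insertionPoly_rank_card`): `θ₀ Φ = Σ X₁^k ι(θ c_k)`, `θ₁ Φ = Σ X₁^k ι(k c_k)` (`θ = X d/dX`), hence the
line's bordered log-Hessian `H(Φ) = θ₀θ₀Φ·(θ₁Φ)² − 2 θ₀θ₁Φ·θ₀Φ·θ₁Φ + θ₁θ₁Φ·(θ₀Φ)²` is, at `p = (t, b)`, the value of the
bivariate polynomial `HH = A·B² − 2·Cc·D·B + E·D² ∈ ℝ[X][X]` (`A = Σ C(θθc_k) X^k`, `B = Σ C(k c_k) X^k`, …) specialised at
`t` and evaluated at `b` (`eval_logHessian_sum`), while `Φ(p)` is the value of `PP = Σ C(c_k) X^k` (`eval_sum_letter`).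
Bookkeeping for the uniform count: `PP`, `HH` are ISOBARIC of weights `α`, `3α` when `supp c_k ⊆ (α − k) • E`
(`isobaric_PP`, `isobaric_HH`); `PP(t,·) ≡ 0 ⇒ HH(t,·) ≡ 0` (`HH_map_eq_zero`); `PP(t,·)` in the `X^k · C` form of
`OsculationLetter.splits_letter_at` (`PP_map_eq`).

Honest framing: helper algebra toward a UNIFORM Descartes ceiling for the osculation-law columns of an UNREGISTERED V1
law line; `OsculationLaw` (all `m`), `PeelInequality`, `MatrixDescartes`, Conjecture B and `VP ≠ VNP` are OPEN / NOT
proved.  No definitions, no named facts; Mathlib + tree files only.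
-/

-- `Summit.ValiantsHypothesis.ValiantsHypothesis.…` is the tree's mandated single-conjunct layout (Sub = Summit).
set_option linter.dupNamespace false

noncomputable section

namespace Summit.ValiantsHypothesis.ValiantsHypothesis.Theorems.LacunarySymmetroidMatrixDescartes

namespace OsculationUniform

open Polynomial
open scoped BigOperators Pointwise

/-! ### θ-calculus on `Σ X₁^k ι(c_k)` -/

/-- `X₁ · ∂₁ (X₁^k) = k · X₁^k`. [folklore] -/
theorem X1_mul_pderiv_one_pow (k : ℕ) :
    (MvPolynomial.X 1 : MvPolynomial (Fin 2) ℝ) * MvPolynomial.pderiv 1 ((MvPolynomial.X 1 : MvPolynomial (Fin 2) ℝ) ^ k) =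
      (k : MvPolynomial (Fin 2) ℝ) * (MvPolynomial.X 1) ^ k := by
  induction k with
  | zero => simp
  | succ k ih =>
    rw [pow_succ, Derivation.leibniz, smul_eq_mul, smul_eq_mul, MvPolynomial.pderiv_X_self, mul_add,
      ← mul_assoc, mul_comm (MvPolynomial.X 1) ((MvPolynomial.X 1) ^ k), mul_assoc, ih, Nat.cast_succ]
    ring

/-- `∂₀ (X₁^k) = 0`. [folklore] -/
theorem pderiv_zero_X1_pow (k : ℕ) :
    MvPolynomial.pderiv 0 ((MvPolynomial.X 1 : MvPolynomial (Fin 2) ℝ) ^ k) = 0 := by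
  induction k with
  | zero => simp
  | succ k ih =>
    rw [pow_succ, Derivation.leibniz, ih, MvPolynomial.pderiv_X_of_ne (show (1 : Fin 2) ≠ 0 by decide), smul_zero,
      smul_zero, add_zero]

/-- `θ₀ (Σ X₁^k ι c_k) = Σ X₁^k ι(θ c_k)`. [folklore] -/
theorem euler_zero_sum (c : ℕ → ℝ[X]) (n : ℕ) :
    (MvPolynomial.X 0 : MvPolynomial (Fin 2) ℝ) * MvPolynomial.pderiv 0
        (∑ k ∈ Finset.range (n + 1), (MvPolynomial.X 1 : MvPolynomial (Fin 2) ℝ) ^ k *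
          Polynomial.aeval (MvPolynomial.X 0 : MvPolynomial (Fin 2) ℝ) (c k)) =
      ∑ k ∈ Finset.range (n + 1), (MvPolynomial.X 1 : MvPolynomial (Fin 2) ℝ) ^ k *
        Polynomial.aeval (MvPolynomial.X 0 : MvPolynomial (Fin 2) ℝ) (X * derivative (c k)) := by
  rw [map_sum, Finset.mul_sum]
  refine Finset.sum_congr rfl fun k _ => ?_
  rw [Derivation.leibniz, smul_eq_mul, smul_eq_mul, pderiv_zero_X1_pow, mul_zero, add_zero,
    OsculationRankOne.pderiv_zero_aevalX0, map_mul, Polynomial.aeval_X]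
  ring

/-- `θ₁ (Σ X₁^k ι c_k) = Σ X₁^k ι(k · c_k)`. [folklore] -/
theorem euler_one_sum (c : ℕ → ℝ[X]) (n : ℕ) :
    (MvPolynomial.X 1 : MvPolynomial (Fin 2) ℝ) * MvPolynomial.pderiv 1
        (∑ k ∈ Finset.range (n + 1), (MvPolynomial.X 1 : MvPolynomial (Fin 2) ℝ) ^ k *
          Polynomial.aeval (MvPolynomial.X 0 : MvPolynomial (Fin 2) ℝ) (c k)) =
      ∑ k ∈ Finset.range (n + 1), (MvPolynomial.X 1 : MvPolynomial (Fin 2) ℝ) ^ k *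
        Polynomial.aeval (MvPolynomial.X 0 : MvPolynomial (Fin 2) ℝ) (C (k : ℝ) * c k) := by
  rw [map_sum, Finset.mul_sum]
  refine Finset.sum_congr rfl fun k _ => ?_
  rw [Derivation.leibniz, smul_eq_mul, smul_eq_mul, OsculationRankOne.pderiv_one_aevalX0, mul_zero, zero_add,
    map_mul, Polynomial.aeval_C, MvPolynomial.algebraMap_eq, map_natCast]
  calc (MvPolynomial.X 1 : MvPolynomial (Fin 2) ℝ) * (Polynomial.aeval (MvPolynomial.X 0 : MvPolynomial (Fin 2) ℝ) (c k) *
          MvPolynomial.pderiv 1 ((MvPolynomial.X 1 : MvPolynomial (Fin 2) ℝ) ^ k))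
        = Polynomial.aeval (MvPolynomial.X 0 : MvPolynomial (Fin 2) ℝ) (c k) *
          ((MvPolynomial.X 1 : MvPolynomial (Fin 2) ℝ) * MvPolynomial.pderiv 1 ((MvPolynomial.X 1 : MvPolynomial (Fin 2) ℝ) ^ k)) := by
          ring
    _ = (MvPolynomial.X 1 : MvPolynomial (Fin 2) ℝ) ^ k * ((k : MvPolynomial (Fin 2) ℝ) *
          Polynomial.aeval (MvPolynomial.X 0 : MvPolynomial (Fin 2) ℝ) (c k)) := by
          rw [X1_mul_pderiv_one_pow]; ring

/-- `θ (C a · f) = C a · θ f` in `ℝ[X]`. [folklore] -/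
theorem theta_C_mul (a : ℝ) (f : ℝ[X]) : X * derivative (C a * f) = C a * (X * derivative f) := by
  rw [derivative_C_mul]; ring

/-- Evaluation: `Φ(p) = Σ c_k(p₀) · p₁^k`. [folklore] -/
theorem eval_sum_letter (c : ℕ → ℝ[X]) (n : ℕ) (p : Fin 2 → ℝ) :
    MvPolynomial.eval p (∑ k ∈ Finset.range (n + 1), (MvPolynomial.X 1 : MvPolynomial (Fin 2) ℝ) ^ k *
        Polynomial.aeval (MvPolynomial.X 0 : MvPolynomial (Fin 2) ℝ) (c k)) =
      ∑ k ∈ Finset.range (n + 1), (c k).eval (p 0) * p 1 ^ k := by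
  rw [map_sum]
  refine Finset.sum_congr rfl fun k _ => ?_
  rw [map_mul, map_pow, MvPolynomial.eval_X, OsculationRankOne.eval_aevalX0, mul_comm]

/-- Evaluation of the bivariate form: `PP(t, b) = Σ c_k(t) · b^k`. [folklore] -/
theorem eval_map_PP (c : ℕ → ℝ[X]) (n : ℕ) (t b : ℝ) :
    ((∑ k ∈ Finset.range (n + 1), C (c k) * X ^ k : ℝ[X][X]).map (evalRingHom t)).eval b =
      ∑ k ∈ Finset.range (n + 1), (c k).eval t * b ^ k := by
  rw [Polynomial.map_sum, eval_finsetSum]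
  refine Finset.sum_congr rfl fun k _ => ?_
  rw [Polynomial.map_mul, Polynomial.map_pow, map_X, map_C, eval_mul, eval_pow, eval_X, eval_C, coe_evalRingHom]

/-- The specialised letter in the form of `OsculationLetter.splits_letter_at`: `PP(t,·) = Σ X^k · C(c_k(t))`. [folklore] -/
theorem PP_map_eq (c : ℕ → ℝ[X]) (n : ℕ) (t : ℝ) :
    (∑ k ∈ Finset.range (n + 1), C (c k) * X ^ k : ℝ[X][X]).map (evalRingHom t) =
      ∑ k ∈ Finset.range (n + 1), (X : ℝ[X]) ^ k * C ((c k).eval t) := by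
  rw [Polynomial.map_sum]
  refine Finset.sum_congr rfl fun k _ => ?_
  rw [Polynomial.map_mul, Polynomial.map_pow, map_X, map_C, coe_evalRingHom, mul_comm]

/-! ### The bordered log-Hessian of a general letter -/

/-- Evaluation of the Hessian SHAPE for five arbitrary coefficient families. [folklore] -/
theorem eval_shape (a b cc d e : ℕ → ℝ[X]) (n : ℕ) (p : Fin 2 → ℝ) :
    MvPolynomial.eval p
        ((∑ k ∈ Finset.range (n + 1), (MvPolynomial.X 1 : MvPolynomial (Fin 2) ℝ) ^ k *
            Polynomial.aeval (MvPolynomial.X 0 : MvPolynomial (Fin 2) ℝ) (a k)) *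
          (∑ k ∈ Finset.range (n + 1), (MvPolynomial.X 1 : MvPolynomial (Fin 2) ℝ) ^ k *
            Polynomial.aeval (MvPolynomial.X 0 : MvPolynomial (Fin 2) ℝ) (b k)) ^ 2
        - 2 * (∑ k ∈ Finset.range (n + 1), (MvPolynomial.X 1 : MvPolynomial (Fin 2) ℝ) ^ k *
            Polynomial.aeval (MvPolynomial.X 0 : MvPolynomial (Fin 2) ℝ) (cc k)) *
          (∑ k ∈ Finset.range (n + 1), (MvPolynomial.X 1 : MvPolynomial (Fin 2) ℝ) ^ k *
            Polynomial.aeval (MvPolynomial.X 0 : MvPolynomial (Fin 2) ℝ) (d k)) *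
          (∑ k ∈ Finset.range (n + 1), (MvPolynomial.X 1 : MvPolynomial (Fin 2) ℝ) ^ k *
            Polynomial.aeval (MvPolynomial.X 0 : MvPolynomial (Fin 2) ℝ) (b k))
        + (∑ k ∈ Finset.range (n + 1), (MvPolynomial.X 1 : MvPolynomial (Fin 2) ℝ) ^ k *
            Polynomial.aeval (MvPolynomial.X 0 : MvPolynomial (Fin 2) ℝ) (e k)) *
          (∑ k ∈ Finset.range (n + 1), (MvPolynomial.X 1 : MvPolynomial (Fin 2) ℝ) ^ k *
            Polynomial.aeval (MvPolynomial.X 0 : MvPolynomial (Fin 2) ℝ) (d k)) ^ 2) =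
      (((∑ k ∈ Finset.range (n + 1), C (a k) * X ^ k : ℝ[X][X]) *
            (∑ k ∈ Finset.range (n + 1), C (b k) * X ^ k) ^ 2
          - 2 * (∑ k ∈ Finset.range (n + 1), C (cc k) * X ^ k) *
            (∑ k ∈ Finset.range (n + 1), C (d k) * X ^ k) *
            (∑ k ∈ Finset.range (n + 1), C (b k) * X ^ k)
          + (∑ k ∈ Finset.range (n + 1), C (e k) * X ^ k) *
            (∑ k ∈ Finset.range (n + 1), C (d k) * X ^ k) ^ 2).map (evalRingHom (p 0))).eval (p 1) := by
  simp only [map_add, map_sub, map_mul, map_pow, map_ofNat, eval_sum_letter, Polynomial.map_add, Polynomial.map_sub,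
    Polynomial.map_mul, Polynomial.map_pow, Polynomial.map_ofNat, eval_add, eval_sub, eval_mul, eval_pow, eval_ofNat,
    eval_map_PP]

set_option maxHeartbeats 800000 in
/-- **The Hessian at a point, any rank.**  For `Φ = Σ_{k ≤ n} X₁^k ι(c_k)`, the line's bordered log-Hessian at
`p = (t, b)` is the value at `b` of the specialisation at `t` of
`HH = A·B² − 2·Cc·D·B + E·D²`, `A = Σ C(θθc_k)X^k`, `B = Σ C(k c_k)X^k`, `Cc = Σ C(k θc_k)X^k`, `D = Σ C(θc_k)X^k`,
`E = Σ C(k² c_k)X^k`. [folklore] -/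
theorem eval_logHessian_sum (c : ℕ → ℝ[X]) (n : ℕ) (Φ : MvPolynomial (Fin 2) ℝ)
    (hΦ : Φ = ∑ k ∈ Finset.range (n + 1), (MvPolynomial.X 1 : MvPolynomial (Fin 2) ℝ) ^ k *
      Polynomial.aeval (MvPolynomial.X 0 : MvPolynomial (Fin 2) ℝ) (c k)) (p : Fin 2 → ℝ) :
    MvPolynomial.eval p
        (MvPolynomial.X 0 * MvPolynomial.pderiv 0 (MvPolynomial.X 0 * MvPolynomial.pderiv 0 Φ)
            * (MvPolynomial.X 1 * MvPolynomial.pderiv 1 Φ) ^ 2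
          - 2 * (MvPolynomial.X 0 * MvPolynomial.pderiv 0 (MvPolynomial.X 1 * MvPolynomial.pderiv 1 Φ))
            * (MvPolynomial.X 0 * MvPolynomial.pderiv 0 Φ) * (MvPolynomial.X 1 * MvPolynomial.pderiv 1 Φ)
          + MvPolynomial.X 1 * MvPolynomial.pderiv 1 (MvPolynomial.X 1 * MvPolynomial.pderiv 1 Φ)
            * (MvPolynomial.X 0 * MvPolynomial.pderiv 0 Φ) ^ 2) =
      (((∑ k ∈ Finset.range (n + 1), C (X * derivative (X * derivative (c k))) * X ^ k : ℝ[X][X]) *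
            (∑ k ∈ Finset.range (n + 1), C (C (k : ℝ) * c k) * X ^ k) ^ 2
          - 2 * (∑ k ∈ Finset.range (n + 1), C (C (k : ℝ) * (X * derivative (c k))) * X ^ k) *
            (∑ k ∈ Finset.range (n + 1), C (X * derivative (c k)) * X ^ k) *
            (∑ k ∈ Finset.range (n + 1), C (C (k : ℝ) * c k) * X ^ k)
          + (∑ k ∈ Finset.range (n + 1), C (C (k : ℝ) * (C (k : ℝ) * c k)) * X ^ k) *
            (∑ k ∈ Finset.range (n + 1), C (X * derivative (c k)) * X ^ k) ^ 2).map (evalRingHom (p 0))).eval (p 1) := by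
  subst hΦ
  -- the five θ-images, as MvPolynomials
  have h0 := euler_zero_sum c n
  have h1 := euler_one_sum c n
  have h00 := euler_zero_sum (fun k => X * derivative (c k)) n
  have h01 : (MvPolynomial.X 0 : MvPolynomial (Fin 2) ℝ) * MvPolynomial.pderiv 0
        (∑ k ∈ Finset.range (n + 1), (MvPolynomial.X 1 : MvPolynomial (Fin 2) ℝ) ^ k *
          Polynomial.aeval (MvPolynomial.X 0 : MvPolynomial (Fin 2) ℝ) (C (k : ℝ) * c k)) =
      ∑ k ∈ Finset.range (n + 1), (MvPolynomial.X 1 : MvPolynomial (Fin 2) ℝ) ^ k *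
        Polynomial.aeval (MvPolynomial.X 0 : MvPolynomial (Fin 2) ℝ) (C (k : ℝ) * (X * derivative (c k))) := by
    rw [euler_zero_sum]
    refine Finset.sum_congr rfl fun k _ => ?_
    rw [theta_C_mul]
  have h11 := euler_one_sum (fun k => C (k : ℝ) * c k) n
  rw [h0, h1, h00, h01, h11]
  exact eval_shape _ _ _ _ _ n p

/-! ### Bookkeeping: isobaric weights, vertical rays -/

/-- `C a · f` does not enlarge the support. [folklore] -/
theorem supp_C_mul {S : Finset ℕ} {f : ℝ[X]} (a : ℝ) (hf : f.support ⊆ S) : (C a * f).support ⊆ S := by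
  rw [C_mul']; exact (support_smul _ _).trans hf

/-- `PP = Σ C(c_k) X^k` is isobaric of weight `α` when `supp c_k ⊆ (α − k) • E` (`k ≤ n ≤ α`). [folklore] -/
theorem isobaric_PP (E : Finset ℕ) (c : ℕ → ℝ[X]) (n α : ℕ) (hn : n ≤ α)
    (hc : ∀ k, k ≤ n → (c k).support ⊆ (α - k) • E) :
    (∀ j, j ≤ α → ((∑ k ∈ Finset.range (n + 1), C (c k) * X ^ k : ℝ[X][X]).coeff j).support ⊆ (α - j) • E) ∧
      (∀ j, α < j → (∑ k ∈ Finset.range (n + 1), C (c k) * X ^ k : ℝ[X][X]).coeff j = 0) :=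
  isobaric_sum_C_mul_X_pow E c n α hn hc

/-- `HH` is isobaric of weight `3α`. [folklore] -/
theorem isobaric_HH (E : Finset ℕ) (c : ℕ → ℝ[X]) (n α : ℕ) (hn : n ≤ α)
    (hc : ∀ k, k ≤ n → (c k).support ⊆ (α - k) • E) :
    (∀ j, j ≤ 3 * α → (((∑ k ∈ Finset.range (n + 1), C (X * derivative (X * derivative (c k))) * X ^ k : ℝ[X][X]) *
            (∑ k ∈ Finset.range (n + 1), C (C (k : ℝ) * c k) * X ^ k) ^ 2
          - 2 * (∑ k ∈ Finset.range (n + 1), C (C (k : ℝ) * (X * derivative (c k))) * X ^ k) *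
            (∑ k ∈ Finset.range (n + 1), C (X * derivative (c k)) * X ^ k) *
            (∑ k ∈ Finset.range (n + 1), C (C (k : ℝ) * c k) * X ^ k)
          + (∑ k ∈ Finset.range (n + 1), C (C (k : ℝ) * (C (k : ℝ) * c k)) * X ^ k) *
            (∑ k ∈ Finset.range (n + 1), C (X * derivative (c k)) * X ^ k) ^ 2).coeff j).support ⊆ (3 * α - j) • E) ∧
      (∀ j, 3 * α < j → ((∑ k ∈ Finset.range (n + 1), C (X * derivative (X * derivative (c k))) * X ^ k : ℝ[X][X]) *
            (∑ k ∈ Finset.range (n + 1), C (C (k : ℝ) * c k) * X ^ k) ^ 2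
          - 2 * (∑ k ∈ Finset.range (n + 1), C (C (k : ℝ) * (X * derivative (c k))) * X ^ k) *
            (∑ k ∈ Finset.range (n + 1), C (X * derivative (c k)) * X ^ k) *
            (∑ k ∈ Finset.range (n + 1), C (C (k : ℝ) * c k) * X ^ k)
          + (∑ k ∈ Finset.range (n + 1), C (C (k : ℝ) * (C (k : ℝ) * c k)) * X ^ k) *
            (∑ k ∈ Finset.range (n + 1), C (X * derivative (c k)) * X ^ k) ^ 2).coeff j = 0) := by
  have hA := isobaric_sum_C_mul_X_pow E (fun k => X * derivative (X * derivative (c k))) n α hn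
    fun k hk => OsculationCusp.supp_theta (OsculationCusp.supp_theta (hc k hk))
  have hB := isobaric_sum_C_mul_X_pow E (fun k => C (k : ℝ) * c k) n α hn fun k hk => supp_C_mul _ (hc k hk)
  have hCc := isobaric_sum_C_mul_X_pow E (fun k => C (k : ℝ) * (X * derivative (c k))) n α hn
    fun k hk => supp_C_mul _ (OsculationCusp.supp_theta (hc k hk))
  have hD := isobaric_sum_C_mul_X_pow E (fun k => X * derivative (c k)) n α hn
    fun k hk => OsculationCusp.supp_theta (hc k hk)
  have hE' := isobaric_sum_C_mul_X_pow E (fun k => C (k : ℝ) * (C (k : ℝ) * c k)) n α hn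
    fun k hk => supp_C_mul _ (supp_C_mul _ (hc k hk))
  -- `A · B²`
  have hB2 := isobaric_mul E _ _ α α hB.1 hB.2 hB.1 hB.2
  rw [← pow_two] at hB2
  have h1 := isobaric_mul E _ _ α (α + α) hA.1 hA.2 hB2.1 hB2.2
  -- `2 · Cc · D · B`
  have h2a := isobaric_ofNat_mul E _ α 2 hCc.1 hCc.2
  have h2b := isobaric_mul E _ _ α α h2a.1 h2a.2 hD.1 hD.2
  have h2 := isobaric_mul E _ _ (α + α) α h2b.1 h2b.2 hB.1 hB.2
  -- `E · D²`
  have hD2 := isobaric_mul E _ _ α α hD.1 hD.2 hD.1 hD.2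
  rw [← pow_two] at hD2
  have h3 := isobaric_mul E _ _ α (α + α) hE'.1 hE'.2 hD2.1 hD2.2
  have e3 : α + (α + α) = 3 * α := by ring
  have e3' : α + α + α = 3 * α := by ring
  rw [e3] at h1 h3
  rw [e3'] at h2
  have h12 := isobaric_sub E _ _ (3 * α) h1.1 h1.2 h2.1 h2.2
  exact isobaric_add E _ _ (3 * α) h12.1 h12.2 h3.1 h3.2

/-- **Vertical rays**: if `PP(t,·) ≡ 0` then `HH(t,·) ≡ 0` (each term of `HH` carries an underived coefficient).
[folklore] -/
theorem HH_map_eq_zero (c : ℕ → ℝ[X]) (n : ℕ) (t : ℝ)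
    (h : (∑ k ∈ Finset.range (n + 1), C (c k) * X ^ k : ℝ[X][X]).map (evalRingHom t) = 0) :
    ((∑ k ∈ Finset.range (n + 1), C (X * derivative (X * derivative (c k))) * X ^ k : ℝ[X][X]) *
            (∑ k ∈ Finset.range (n + 1), C (C (k : ℝ) * c k) * X ^ k) ^ 2
          - 2 * (∑ k ∈ Finset.range (n + 1), C (C (k : ℝ) * (X * derivative (c k))) * X ^ k) *
            (∑ k ∈ Finset.range (n + 1), C (X * derivative (c k)) * X ^ k) *
            (∑ k ∈ Finset.range (n + 1), C (C (k : ℝ) * c k) * X ^ k)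
          + (∑ k ∈ Finset.range (n + 1), C (C (k : ℝ) * (C (k : ℝ) * c k)) * X ^ k) *
            (∑ k ∈ Finset.range (n + 1), C (X * derivative (c k)) * X ^ k) ^ 2).map (evalRingHom t) = 0 := by
  -- all `c_k(t)` vanish
  have hck : ∀ k, k ≤ n → (c k).eval t = 0 := by
    intro k hk
    have := congr_arg (fun q : ℝ[X] => q.coeff k) h
    simp only [Polynomial.map_sum, Polynomial.map_mul, Polynomial.map_pow, map_X, map_C, coe_evalRingHom,
      finsetSum_coeff, coeff_C_mul_X_pow, coeff_zero] at this
    rw [Finset.sum_ite_eq (Finset.range (n + 1)) k, if_pos (Finset.mem_range.2 (by omega))] at this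
    exact this
  have hB : (∑ k ∈ Finset.range (n + 1), C (C (k : ℝ) * c k) * X ^ k : ℝ[X][X]).map (evalRingHom t) = 0 := by
    rw [Polynomial.map_sum]
    refine Finset.sum_eq_zero fun k hk => ?_
    have hk' : k ≤ n := by have := Finset.mem_range.1 hk; omega
    simp [Polynomial.map_mul, Polynomial.map_pow, hck k hk']
  have hE : (∑ k ∈ Finset.range (n + 1), C (C (k : ℝ) * (C (k : ℝ) * c k)) * X ^ k : ℝ[X][X]).map (evalRingHom t) = 0 := by
    rw [Polynomial.map_sum]
    refine Finset.sum_eq_zero fun k hk => ?_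
    have hk' : k ≤ n := by have := Finset.mem_range.1 hk; omega
    simp [Polynomial.map_mul, Polynomial.map_pow, hck k hk']
  rw [Polynomial.map_add, Polynomial.map_sub, Polynomial.map_mul, Polynomial.map_mul, Polynomial.map_mul,
    Polynomial.map_mul, Polynomial.map_mul, Polynomial.map_pow, Polynomial.map_pow, hB, hE]
  simp

end OsculationUniform

end Summit.ValiantsHypothesis.ValiantsHypothesis.Theorems.LacunarySymmetroidMatrixDescartes
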